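import Mathlib
import HarnessLib
import Summits.ResolutionOfSingularities.ResolutionOfSingularities.Theorems.HomologicalConductorNoZenoCaPrincipalSky

/-!
# Crux `NoZeno` / `NoZenoR` (stmt-ResolutionOfSingularities-16483 / -19943), line `sandwich-cluster`,
# stub `stub_skyPrincipal` — Layer 1, P1.3 (the lifting lemma), RING-THEORETIC HALF:
# a sky point is the local ring of a point of a blow-up model of the stage

Route `ResolutionOfSingularities/HomologicalConductor`.  OURS (cell res-hironaka, crux chain W4.4, seat
res-D-pv-038 acting as res-L0-w44-stub-6; CHAIN v6 §2 row «stub-6»); nothing here is a statement of the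
manuscript under review (Hironaka 2017); AI-written, weaker than expert review.

The registered stub `stub_skyPrincipal` (skeleton v14) asks that `ca(T_m)·S` be principal for a SKY POINT
`S` of the singular sandwiched stage `T_m = tower O A m`: a two-dimensional regular local `k`-subalgebra
`S ⊇ T_m` of `K` which is the end of a chain of quadratic transforms `R = Q₀ → Q₁ → ⋯ → Q → S` starting
at the regular ring `R` below the stages, with `T_m ⊄ Q`.  The planned proof (CRUX-PLAN W4.4 §B, P1.3)
places `S` as a CLOSED POINT OF THE MINIMAL RESOLUTION of `Spec T_m`; its first half, proved here without
any scheme, says that `S` is the local ring of a point of a BLOW-UP MODEL of `Spec T_m` lying over the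
closed point — in the tree's Novacoski–Spivakovsky vocabulary (`Resolution/LocalBlowup.lean`):

* `locAtCentre_eq_self_of_subringDominates` — a subring dominated by the valuation ring `O` is its own
  localisation at the centre of `O`;
* `reflTransGen_isLocalBlowup_of_isQuadraticTransform` — a chain of quadratic transforms issuing from a
  two-dimensional regular local ring of `K` and ending at a ring which is not a valuation ring of `K` is a
  chain of local blowing ups with respect to EVERY valuation ring `O` dominating its end (each step is
  the quadratic transform ALONG `O`, `IsQuadraticTransform.along`);
* `isLocalBlowup_of_reflTransGen_isQuadraticTransform` — hence its end is ONE local blowing up of its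
  source (`isLocalBlowup_of_transGen`, Novacoski–Spivakovsky Lemma 2.9);
* `isLocalBlowup_of_le_of_le` — SANDWICH: if `S` is a local blowing up of `R₀` with respect to `O` and
  `R₀ ≤ T ≤ S`, then `S` is a local blowing up of `T` (same finite set of new elements);
* `exists_isLocalBlowupAlong_of_isLocalBlowup` — over a subring `T` with quotient field `K`, a local
  blowing up `S` of `T` is the local blowing up ALONG a nonzero finitely generated ideal `I` of `T`
  (clear denominators: `S = (T[I/d])_{𝔪_O ∩ T[I/d]}`, the local ring at the centre of `O` on the
  `d`-chart of the blowing up of `Spec T` along `I`);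
* `exists_finset_of_isLocalBlowup` — the valuation-free reading: `S` is the localisation of a finitely
  generated `T[t] ≤ S` at the prime under `𝔪_S` (every element of `S` is `a/b`, `a, b ∈ T[t]`, `b⁻¹ ∈ S`);
* `exists_valuationSubring_subringDominates` — some valuation ring of `K` dominates a given local subring
  (Chevalley; Mathlib `LocalSubring.exists_le_valuationSubring`), so the above is never vacuous;
* **`skyPoint_isLocalBlowup`** — the assembly with the binders of `stub_skyPrincipal`: for every
  valuation ring `O'` dominating the sky point `S`, `S` is a local blowing up of `R`, of `T_m`, and the
  local blowing up of `T_m` along some nonzero ideal, with respect to `O'`;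
  `skyPoint_exists_finset` — the valuation-free form.

The second half of P1.3 (the resolved model through `S` and the factorisation through the minimal
resolution) is scheme theory and is not done here.

References: S. Abhyankar, Amer. J. Math. 78 (1956), Thm. 3 [`Abhyankar1956Valuations`]; J. Novacoski,
M. Spivakovsky, *Reduction of local uniformization to the rank one case*, Valuation theory in interaction
(2014), Def. 2.8, 2.11, Lemma 2.9 [`NovacoskiSpivakovsky2014`]; S. D. Cutkosky, Counterexamples to local
monomialization in positive characteristic, Math. Ann. 362 (2015) §2 [`Cutkosky2014`].
-/

noncomputable section

-- single-problem summit: the doubled namespace component `ResolutionOfSingularities` is forced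
set_option linter.dupNamespace false

namespace Summit.ResolutionOfSingularities.ResolutionOfSingularities.Theorems.NoZeno.SandwichCluster

open IsLocalRing Literature.AlgebraicGeometry.Resolution
open Summit.ResolutionOfSingularities.ResolutionOfSingularities.Theorems
open Summit.ResolutionOfSingularities.ResolutionOfSingularities.Theorems.NoZeno.Birth
open Summit.ResolutionOfSingularities.ResolutionOfSingularities.Theses.HomologicalConductor

variable {k K : Type} [Field k] [Field K] [Algebra k K]

/-! ## Local rings dominated by a valuation ring -/

/-- A subring of `K` dominated by the valuation ring `O` is its own localisation at the centre of `O`: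
a denominator of value `1` is a unit of `O`, hence of the subring. [cite: NovacoskiSpivakovsky2014, Def. 2.8] -/
theorem locAtCentre_eq_self_of_subringDominates {B : Subring K} {O : ValuationSubring K}
    (h : SubringDominates B O.toSubring) : locAtCentre B O = B := by
  refine le_antisymm ?_ (le_locAtCentre B O)
  rintro _ ⟨y, hy, z, hz, hv, rfl⟩
  have hzO : z⁻¹ ∈ O.toSubring := by
    change z⁻¹ ∈ O
    rw [← O.valuation_le_one_iff, map_inv₀, hv, inv_one]
  rw [div_eq_mul_inv]
  exact B.mul_mem hy (h.2 z hz hzO)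

/-- Some valuation ring of `K` dominates a given local subring of `K` (Chevalley's extension theorem,
Mathlib `LocalSubring.exists_le_valuationSubring`, read through `subringDominates_iff`). [folklore] -/
theorem exists_valuationSubring_subringDominates (S : Subring K) [IsLocalRing S] :
    ∃ O : ValuationSubring K, SubringDominates S O.toSubring := by
  obtain ⟨O, hO⟩ := LocalSubring.exists_le_valuationSubring (LocalSubring.mk S)
  refine ⟨O, ?_⟩
  haveI : IsLocalRing O.toSubring := (inferInstance : IsLocalRing O)
  exact (subringDominates_iff S O.toSubring).mpr hO

/-! ## Chains of quadratic transforms are towers of local blowing ups -/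

/-- **A chain of quadratic transforms is a chain of local blowing ups with respect to every valuation
ring dominating its end.**  For a chain `R₀ → ⋯ → Q` of quadratic transforms from a two-dimensional
regular local ring `R₀` of `K` to a ring `Q` which is not a valuation ring of `K`, and a valuation ring
`O` of `K` dominating `Q`: every member is a two-dimensional regular local ring dominated by `O`
(Huneke–Swanson 14.5.2 along the chain; domination descends the chain), so each step is the quadratic
transform ALONG `O` (`IsQuadraticTransform.along`), a local blowing up with respect to `O`.
[cite: Cutkosky2014, §2.2; NovacoskiSpivakovsky2014, Def. 2.11] -/
theorem reflTransGen_isLocalBlowup_of_isQuadraticTransform {R₀ Q : Subring K}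
    (hreg : IsRegularLocalRing ↥R₀) (hdim : ringKrullDim ↥R₀ = 2) (hof : IsLocalRingOf R₀)
    (h : Relation.ReflTransGen IsQuadraticTransform R₀ Q) (hnv : ¬ ∀ z : K, z ∈ Q ∨ z⁻¹ ∈ Q)
    {O : ValuationSubring K} (hQO : SubringDominates Q O.toSubring) :
    Relation.ReflTransGen (IsLocalBlowup O) R₀ Q := by
  induction h with
  | refl => exact Relation.ReflTransGen.refl
  | @tail Q₁ Q₂ h₁ h₂ ih =>
    have hnv₁ : ¬ ∀ z : K, z ∈ Q₁ ∨ z⁻¹ ∈ Q₁ := fun hv =>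
      hnv fun z => (hv z).imp (fun hz => h₂.dominates.1 hz) (fun hz => h₂.dominates.1 hz)
    have hQ₁O : SubringDominates Q₁ O.toSubring := h₂.dominates.trans hQO
    obtain ⟨hreg₁, -, -⟩ := isRegularLocalRing_and_ringKrullDim_of_reflTransGen hreg hdim hof h₁ hnv₁
    haveI := hreg₁
    have hfg : ∃ _ : IsLocalRing ↥Q₁, (maximalIdeal ↥Q₁).FG :=
      ⟨inferInstance, IsNoetherian.noetherian _⟩
    exact (ih hnv₁ hQ₁O).tail (h₂.along hfg hQO).isLocalBlowup

/-- **The end of a chain of quadratic transforms is ONE local blowing up of its source**, with respect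
to every valuation ring `O` dominating it (towers of local blowing ups compose, Novacoski–Spivakovsky
Lemma 2.9; the empty chain is the trivial local blowing up `R₀ = (R₀)_{𝔪_O ∩ R₀}`).
[cite: NovacoskiSpivakovsky2014, Lemma 2.9] -/
theorem isLocalBlowup_of_reflTransGen_isQuadraticTransform {R₀ S : Subring K}
    (hreg : IsRegularLocalRing ↥R₀) (hdim : ringKrullDim ↥R₀ = 2) (hof : IsLocalRingOf R₀)
    (h : Relation.ReflTransGen IsQuadraticTransform R₀ S) (hnv : ¬ ∀ z : K, z ∈ S ∨ z⁻¹ ∈ S)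
    {O : ValuationSubring K} (hSO : SubringDominates S O.toSubring) : IsLocalBlowup O R₀ S := by
  have hR₀O : SubringDominates R₀ O.toSubring := (subringDominates_of_reflTransGen h).trans hSO
  rcases Relation.reflTransGen_iff_eq_or_transGen.mp
      (reflTransGen_isLocalBlowup_of_isQuadraticTransform hreg hdim hof h hnv hSO) with rfl | ht
  · have h0 := IsLocalBlowup.locAtCentre_self (O := O) hR₀O.1
    rwa [locAtCentre_eq_self_of_subringDominates hR₀O] at h0
  · exact isLocalBlowup_of_transGen ht

/-! ## Sandwich and the blow-up-model reading -/

/-- **Sandwich.**  If `S` is a local blowing up of `R₀` with respect to `O` and `R₀ ≤ T ≤ S`, then `S`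
is a local blowing up of `T` with respect to `O`, by the same finite set `t` of new elements:
`(R₀[t])_𝔪 ≤ (T[t])_𝔪 ≤ S_𝔪 = S`. [cite: NovacoskiSpivakovsky2014, Lemma 2.5 (1), Def. 2.8] -/
theorem isLocalBlowup_of_le_of_le {O : ValuationSubring K} {R₀ T S : Subring K}
    (h : IsLocalBlowup O R₀ S) (hRT : R₀ ≤ T) (hTS : T ≤ S) : IsLocalBlowup O T S := by
  have hSO : S ≤ O.toSubring := h.target_le
  have hlocS : locAtCentre S O = S := h.locAtCentre_eq
  obtain ⟨-, t, ht, hS⟩ := h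
  have htS : (↑t : Set K) ⊆ S := by
    rw [hS]
    exact (Set.subset_union_right.trans Subring.subset_closure).trans (le_locAtCentre _ O)
  refine ⟨hTS.trans hSO, t, ht, le_antisymm ?_ ?_⟩
  · calc S = locAtCentre (Subring.closure ((R₀ : Set K) ∪ ↑t)) O := hS
      _ ≤ locAtCentre (Subring.closure ((T : Set K) ∪ ↑t)) O :=
        locAtCentre_mono O (Subring.closure_mono (Set.union_subset_union_left _ fun x hx => hRT hx))
  · calc locAtCentre (Subring.closure ((T : Set K) ∪ ↑t)) O ≤ locAtCentre S O :=
        locAtCentre_mono O (Subring.closure_le.mpr (Set.union_subset (fun x hx => hTS hx) htS))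
      _ = S := hlocS

/-- **A local blowing up of a subring `T` with quotient field `K` is the local blowing up along a nonzero
finitely generated ideal of `T`.**  Write the new elements `t` over a common denominator `d ∈ T`,
`d ≠ 0`; with `I := (d, z·d : z ∈ t)` one has `T[I/d] = T[t]` (the new generators are `d/d = 1` and
`z·d/d = z`), `d` has the least value among these generators (each `z ∈ t` lies in `O`), and so
`S = (T[I/d])_{𝔪_O ∩ T[I/d]}` — the local ring at the centre of `O` of the `d`-chart of the blowing up
of `Spec T` along `I`. [cite: NovacoskiSpivakovsky2014, Def. 2.8, Def. 2.11] -/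
theorem exists_isLocalBlowupAlong_of_isLocalBlowup {O : ValuationSubring K} {T S : Subring K}
    (h : IsLocalBlowup O T S) (hT : ∀ z : K, ∃ a ∈ T, ∃ b ∈ T, b ≠ 0 ∧ z = a / b) :
    ∃ I : Ideal ↥T, I ≠ ⊥ ∧ IsLocalBlowupAlong O T I S := by
  classical
  obtain ⟨hTO, t, ht, hS⟩ := h
  choose num hnum den hden hden0 heq using hT
  -- a common denominator for the finite set `t`
  set d : K := ∏ z ∈ t, den z with hd
  have hdT : d ∈ T := prod_mem fun z _ => hden z
  have hd0 : d ≠ 0 := Finset.prod_ne_zero_iff.mpr fun z _ => hden0 z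
  have hmul : ∀ z ∈ t, z * d ∈ T := by
    intro z hz
    have hsplit : d = den z * ∏ w ∈ t.erase z, den w := (Finset.mul_prod_erase t den hz).symm
    rw [hsplit, ← mul_assoc, (eq_div_iff (hden0 z)).mp (heq z)]
    exact T.mul_mem (hnum z) (prod_mem fun w _ => hden w)
  -- the generators `d` and `z·d`, `z ∈ t`
  let d' : ↥T := ⟨d, hdT⟩
  let f : {z // z ∈ t} → ↥T := fun z => ⟨(z : K) * d, hmul z z.2⟩
  let u : Finset ↥T := insert d' (t.attach.image f)
  have hd'0 : d' ≠ 0 := fun e => hd0 (by simpa [d'] using congrArg Subtype.val e)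
  have hmem_u : ∀ x ∈ u, (x : K) = d ∨ ∃ z ∈ t, (x : K) = z * d := by
    intro x hx
    rcases Finset.mem_insert.mp hx with rfl | hx
    · exact Or.inl rfl
    · obtain ⟨z, -, rfl⟩ := Finset.mem_image.mp hx
      exact Or.inr ⟨z, z.2, rfl⟩
  refine ⟨Ideal.span (↑u : Set ↥T), ?_, hTO, u, d', rfl, Finset.mem_insert_self _ _, hd'0, ?_, ?_⟩
  · -- `I ≠ ⊥`: it contains `d ≠ 0`
    intro hbot
    have hdI : d' ∈ Ideal.span (↑u : Set ↥T) := Ideal.subset_span (Finset.mem_insert_self _ _)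
    rw [hbot, Ideal.mem_bot] at hdI
    exact hd'0 hdI
  · -- `d` has the least value among the generators
    intro x hx
    rcases hmem_u x hx with hx | ⟨z, hz, hx⟩
    · rw [hx]
    · rw [hx, map_mul]
      calc O.valuation z * O.valuation d ≤ 1 * O.valuation d :=
            mul_le_mul' ((O.valuation_le_one_iff _).mpr (ht (Finset.mem_coe.mpr hz))) le_rfl
        _ = O.valuation (d' : K) := by simp [d']
  · -- the chart ring `T[u/d]` is `T[t]`
    rw [hS]
    congr 1
    apply le_antisymm
    · refine Subring.closure_le.mpr (Set.union_subset (fun x hx => Subring.subset_closure (Or.inl hx)) ?_)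
      intro z hz
      refine Subring.subset_closure (Or.inr ⟨f ⟨z, hz⟩, ?_, ?_⟩)
      · exact Finset.mem_coe.mpr (Finset.mem_insert_of_mem (Finset.mem_image.mpr ⟨⟨z, hz⟩, by simp, rfl⟩))
      · change (z * d) / d = z
        exact mul_div_cancel_right₀ z hd0
    · refine Subring.closure_le.mpr (Set.union_subset (fun x hx => Subring.subset_closure (Or.inl hx)) ?_)
      rintro _ ⟨x, hx, rfl⟩
      change (x : K) / d ∈ Subring.closure ((T : Set K) ∪ ↑t)
      rcases hmem_u x (Finset.mem_coe.mp hx) with hx' | ⟨z, hz, hx'⟩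
      · rw [hx', div_self hd0]
        exact Subring.one_mem _
      · rw [hx', mul_div_cancel_right₀ z hd0]
        exact Subring.subset_closure (Or.inr hz)

/-- **Valuation-free reading of a local blowing up**: if `S` is a local blowing up of `T` with respect
to `O`, then for the finite set `t` of new elements, `t ⊆ S`, `T[t] ≤ S`, and every element of `S` is a
fraction `a/b` with `a, b ∈ T[t]` and `b⁻¹ ∈ S` — `S` is the localisation of the finitely generated
`T`-algebra `T[t]` at the prime below `𝔪_S` (so `S` is essentially of finite type over `T`).
[cite: NovacoskiSpivakovsky2014, Def. 2.8] -/
theorem exists_finset_of_isLocalBlowup {O : ValuationSubring K} {T S : Subring K}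
    (h : IsLocalBlowup O T S) :
    ∃ t : Finset K, (↑t : Set K) ⊆ S ∧ Subring.closure ((T : Set K) ∪ ↑t) ≤ S ∧
      ∀ z ∈ S, ∃ a ∈ Subring.closure ((T : Set K) ∪ ↑t), ∃ b ∈ Subring.closure ((T : Set K) ∪ ↑t),
        b⁻¹ ∈ S ∧ z = a / b := by
  have hle : T ≤ S := h.le
  obtain ⟨hTO, t, ht, hS⟩ := h
  have hCO : Subring.closure ((T : Set K) ∪ ↑t) ≤ O.toSubring :=
    Subring.closure_le.mpr (Set.union_subset hTO ht)
  have hSO : SubringDominates S O.toSubring := by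
    rw [hS]
    exact subringDominates_locAtCentre hCO
  have hCS : Subring.closure ((T : Set K) ∪ ↑t) ≤ S := by
    rw [hS]
    exact le_locAtCentre _ O
  have htS : (↑t : Set K) ⊆ S := (Set.subset_union_right.trans Subring.subset_closure).trans hCS
  refine ⟨t, htS, hCS, fun z hz => ?_⟩
  rw [hS] at hz
  obtain ⟨a, ha, b, hb, hv, rfl⟩ := hz
  have hbO : b⁻¹ ∈ O.toSubring := by
    change b⁻¹ ∈ O
    rw [← O.valuation_le_one_iff, map_inv₀, hv, inv_one]
  exact ⟨a, ha, b, hb, hSO.2 b (hCS hb) hbO, rfl⟩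

/-! ## Sky points of a stage -/

/-- **P1.3, ring-theoretic half: a sky point is the local ring of a point of a blow-up model of the
stage, over the closed point.**  With the binders of `stub_skyPrincipal` (v14) that concern `R`, `T_m`
and `S` — the sandwich context, `T_m ≤ S`, `S` regular of dimension two dominating `R`, and the sky
condition (`S` ends a chain of quadratic transforms issuing from `R`) — and ANY valuation ring `O'` of
`K` dominating `S`: `S` is a local blowing up of `R` and of `T_m` with respect to `O'`, and the local
blowing up of `T_m` along some nonzero finitely generated ideal `I`, i.e.
`S = (T_m[I/d])_{𝔪_{O'} ∩ T_m[I/d]}`, the local ring at the centre of `O'` (a point over `𝔪_{T_m}`,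
as `O'` dominates `S ⊇ T_m`) of the `d`-chart of the blowing up of `Spec T_m` along `I`.
(`R` has dimension two because `tr.deg_k K = 2` and `S ⊇ R` is not a valuation ring.)
[cite: Abhyankar1956Valuations, Thm. 3; NovacoskiSpivakovsky2014, Def. 2.11, Lemma 2.9] -/
theorem skyPoint_isLocalBlowup (p : ℕ) (_hp : p.Prime) (k K : Type) [Field k] [CharP k p]
    [Field K] [Algebra k K] (O : ValuationSubring K) (A R : Subalgebra k K) (m₀ : ℕ)
    (ctx : SandwichCtx O A R m₀) (m : ℕ) (hm : m₀ + 1 ≤ m)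
    (S : Subalgebra k K) (hTS : tower O A m ≤ S) (hS : IsRegularLocalRing ↥S) (hdim : ringKrullDim ↥S = 2)
    (hRS : SubringDominates R.toSubring S.toSubring)
    (hsky : ∃ Q : Subring K, Relation.ReflTransGen IsQuadraticTransform R.toSubring Q ∧
      IsQuadraticTransform Q S.toSubring ∧ ¬ (tower O A m).toSubring ≤ Q)
    (O' : ValuationSubring K) (hSO' : SubringDominates S.toSubring O'.toSubring) :
    IsLocalBlowup O' R.toSubring S.toSubring ∧ IsLocalBlowup O' (tower O A m).toSubring S.toSubring ∧
      ∃ I : Ideal ↥(tower O A m).toSubring, I ≠ ⊥ ∧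
        IsLocalBlowupAlong O' (tower O A m).toSubring I S.toSubring := by
  classical
  have hRreg : IsRegularLocalRing ↥R := ctx.2.2.2.2.2.1
  have hRfr : IsFractionRing ↥R K := ctx.2.2.2.2.2.2.1
  have hRT : R ≤ tower O A m := ctx.2.2.2.2.2.2.2.2.2 m (by omega)
  haveI := hRreg
  haveI := hRfr
  haveI := hS
  -- `R` is a local ring of `K`; `S` is not a valuation ring of `K`
  have hRK : IsLocalRingOf R.toSubring := isLocalRingOf_toSubring R inferInstance hRfr
  have hSnv : ¬ ∀ z : K, z ∈ S.toSubring ∨ z⁻¹ ∈ S.toSubring := by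
    intro hv
    haveI : IsNoetherianRing ↥S.toSubring := (inferInstance : IsNoetherianRing ↥S)
    haveI : IsLocalRing ↥S.toSubring := (inferInstance : IsLocalRing ↥S)
    have h1 : ringKrullDim ↥S.toSubring ≤ 1 :=
      Literature.AlgebraicGeometry.Resolution.ringKrullDim_le_one_of_forall_mem_or_inv_mem hv
    have h2 : ringKrullDim ↥S ≤ 1 := h1
    rw [hdim] at h2
    exact absurd h2 (by norm_num)
  -- `R` is two-dimensional: otherwise `R`, hence `S`, is a valuation ring of `K`
  have hdimR : ringKrullDim ↥R.toSubring = 2 := by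
    have hd2 : (maximalIdeal ↥R).spanFinrank ≤ 2 := by
      have h := Literature.RingTheory.KrullDimension.spanFinrank_maximalIdeal_le_trdeg_of_injective
        (k := k) (R := ↥R) (L := K) R.val Subtype.val_injective
      rw [ctx.2.2.2.2.1] at h
      exact_mod_cast h
    rcases Nat.lt_or_ge (maximalIdeal ↥R).spanFinrank 2 with hlt | hge
    · exfalso
      have hdim1 : ringKrullDim ↥R ≤ 1 := by
        rw [Literature.RingTheory.KrullDimension.ringKrullDim_eq_spanFinrank]
        exact_mod_cast (show (maximalIdeal ↥R).spanFinrank ≤ 1 by omega)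
      haveI : IsPrincipalIdealRing ↥R := isPrincipalIdealRing_of_ringKrullDim_le_one hdim1
      haveI : ValuationRing ↥R :=
        ((tfae_of_isNoetherianRing_of_isLocalRing_of_isDomain ↥R).out 0 1).mp ‹_›
      apply hSnv
      intro z
      rcases (ValuationRing.iff_isInteger_or_isInteger ↥R K).mp ‹_› z with ⟨r, hr⟩ | ⟨r, hr⟩
      · left; rw [← hr]; exact hRS.1 r.2
      · right; rw [← hr]; exact hRS.1 r.2
    · have hd : (maximalIdeal ↥R).spanFinrank = 2 := le_antisymm hd2 hge
      have : ringKrullDim ↥R = 2 := by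
        rw [Literature.RingTheory.KrullDimension.ringKrullDim_eq_spanFinrank, hd]; rfl
      exact this
  -- the chain `R → ⋯ → Q → S`
  obtain ⟨Q, hRQ, hQS, -⟩ := hsky
  have hchain : Relation.ReflTransGen IsQuadraticTransform R.toSubring S.toSubring := hRQ.tail hQS
  have hR : IsLocalBlowup O' R.toSubring S.toSubring :=
    isLocalBlowup_of_reflTransGen_isQuadraticTransform hRreg hdimR hRK hchain hSnv hSO'
  have hT : IsLocalBlowup O' (tower O A m).toSubring S.toSubring :=
    isLocalBlowup_of_le_of_le hR (fun x hx => hRT hx) (fun x hx => hTS hx)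
  have hTfrac : ∀ z : K, ∃ a ∈ (tower O A m).toSubring, ∃ b ∈ (tower O A m).toSubring,
      b ≠ 0 ∧ z = a / b := fun z => by
    obtain ⟨a, ha, b, hb, hb0, hz⟩ := hRK.2 z
    exact ⟨a, hRT ha, b, hRT hb, hb0, hz⟩
  exact ⟨hR, hT, exists_isLocalBlowupAlong_of_isLocalBlowup hT hTfrac⟩

/-- **P1.3, ring-theoretic half, valuation-free form**: a sky point `S` of the stage `T_m` is the
localisation of a finitely generated `T_m`-subalgebra `T_m[t] ≤ S` (`t ⊆ S` finite) at the prime below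
`𝔪_S`: every element of `S` is `a/b` with `a, b ∈ T_m[t]` and `b⁻¹ ∈ S`.  (`S` is local, so some
valuation ring dominates it and `skyPoint_isLocalBlowup` applies.)
[cite: Abhyankar1956Valuations, Thm. 3; NovacoskiSpivakovsky2014, Lemma 2.9] -/
theorem skyPoint_exists_finset (p : ℕ) (hp : p.Prime) (k K : Type) [Field k] [CharP k p]
    [Field K] [Algebra k K] (O : ValuationSubring K) (A R : Subalgebra k K) (m₀ : ℕ)
    (ctx : SandwichCtx O A R m₀) (m : ℕ) (hm : m₀ + 1 ≤ m)
    (S : Subalgebra k K) (hTS : tower O A m ≤ S) (hS : IsRegularLocalRing ↥S) (hdim : ringKrullDim ↥S = 2)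
    (hRS : SubringDominates R.toSubring S.toSubring)
    (hsky : ∃ Q : Subring K, Relation.ReflTransGen IsQuadraticTransform R.toSubring Q ∧
      IsQuadraticTransform Q S.toSubring ∧ ¬ (tower O A m).toSubring ≤ Q) :
    ∃ t : Finset K, (↑t : Set K) ⊆ S ∧
      Subring.closure (((tower O A m).toSubring : Set K) ∪ ↑t) ≤ S.toSubring ∧
      ∀ z ∈ S, ∃ a ∈ Subring.closure (((tower O A m).toSubring : Set K) ∪ ↑t),
        ∃ b ∈ Subring.closure (((tower O A m).toSubring : Set K) ∪ ↑t), b⁻¹ ∈ S ∧ z = a / b := by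
  haveI := hS
  haveI : IsLocalRing ↥S.toSubring := (inferInstance : IsLocalRing ↥S)
  obtain ⟨O', hSO'⟩ := exists_valuationSubring_subringDominates S.toSubring
  obtain ⟨-, hT, -⟩ := skyPoint_isLocalBlowup p hp k K O A R m₀ ctx m hm S hTS hS hdim hRS hsky O' hSO'
  obtain ⟨t, htS, hCS, hfrac⟩ := exists_finset_of_isLocalBlowup hT
  exact ⟨t, htS, hCS, fun z hz => hfrac z hz⟩

end Summit.ResolutionOfSingularities.ResolutionOfSingularities.Theorems.NoZeno.SandwichCluster

end
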